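import Literature.NumberTheory.NumberFields.IdelicArtinMapOpenSubgroups
import Literature.NumberTheory.NumberFields.IdeleOpenSubgroupFiniteIndex
import Literature.NumberTheory.NumberFields.IdeleStabilizerOfLatticePoints
import Literature.NumberTheory.NumberFields.FiniteIdeleCongruenceSubgroupBasis
import Literature.NumberTheory.GaloisRepresentations.HeckeCharacterAutConj
import Literature.NumberTheory.GaloisRepresentations.HeckeCharacterOfRayClass
import Literature.NumberTheory.GaloisRepresentations.AlgebraicHeckeCharacterGrossencharakterProofs
import HarnessLib

/-!
# The twist character `σ ↦ c_σ = β(y)f(y)⁻¹` of Shimura's proof of Thm. 21.4 is a CONTINUOUS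
# homomorphism `Gal(k^ab/k) → K̂_f^×` (Shimura 1998 §21.4, proof of Thm. 21.4, pp. 147–148 «`c` is uniquely determined by `σ`»,
# with §18.3 and the continuity of `[·, k]`; Tate, Cassels–Fröhlich VII §5.1 (D), §5.4)

Topic `Literature/NumberTheory/ComplexMultiplication`; namespace
`Literature.NumberTheory.ComplexMultiplication`.  PROOF-ONLY file (no definition, no named fact; net
Literature debt 0).  Cell `hodgecm-mathlib`, sub-line `a2b-twisted-galois-model` of the `h21` line
(Shimura 1998 Thm. 21.4 = Casselman), FL adapter (A3) «`c` is continuous» for the stub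
`stub_finiteLevelReciprocity`: the hypothesis `hc` («the stabiliser of every point of `K/𝔞` under
`c_σ` is open», levelwise) of the finite-level engine `GroupTheory/FiniteLevelFactorisation`.

THE SITUATION (Shimura, proof of Thm. 21.4, pp. 147–148).  `k ⊃ K*` a number field, `χ` a Hecke character of `k` whose values
on the idèles with trivial archimedean part lie in `τ₀(K^×)` ((19.10b): «if `x ∈ k_h^×` then
`χ(x) ∈ K^×`», hypothesis `hb`), `f : k_𝐀^× → K̂_f^×` a continuous homomorphism (in Shimura
`f = (g ∘ N_{k/K*})_𝐡`, the finite part of the reflex type norm — here ABSTRACT).  For an idèle `y`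
put `y_fin = (y_∞, 1)⁻¹ y` and `β(y) = τ₀⁻¹(χ(y_fin)) ∈ K^×`; Shimura's twist is the finite idèle
`c(y) = β(y) f(y)⁻¹` of `K` (acting on `K/𝔞` by §18.3).  «`c` is uniquely determined by `σ = [y, k]`»
is taken here as the HYPOTHESIS `hindep` (it is the content of the tree's stub
`stub_twistIdeleIndependent`, class field theory + (19.10a)): `[y, k] = [y′, k]` implies
`β(y) f(y)⁻¹ = β(y′) f(y′)⁻¹`.

WHAT IS PROVED.
* §1 `HeckeCharacter.exists_isOpen_subgroup_apply_finitePart_eq_one` — `y ↦ χ(y_fin)` has OPEN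
  kernel in `k_𝐀^×` (a module of definition of `χ`, `exists_isModulus`: `χ` kills the unit idèles
  congruent to `1` modulo the conductor; the unit idèles are open).
* §2 `exists_twistIdeleHom` — `y ↦ c(y) = β(y) f(y)⁻¹` IS a homomorphism `T : k_𝐀^× →* K̂_f^×`
  (`β` is multiplicative because `τ₀` is injective and `χ` multiplicative), characterised by
  `T y = b · f(y)⁻¹` whenever `χ(y_fin) = τ₀ b`.
* §3 `exists_twistHom_ideleArtinMap` — under `hindep`, `T` factors through Shimura's `[·, k]`
  (`NumberFields.ideleArtinMap`, onto `Gal(k^ab/k)`): a homomorphism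
  `t̄ : Gal(k^ab/k) →* K̂_f^×` with `t̄ [y, k] = b · f(y)⁻¹` whenever `χ(y_fin) = τ₀ b`; it is unique
  (`twistHom_unique`).
* §4 **`isOpen_comap_twistHom`** — for every OPEN subgroup `W ≤ K̂_f^×`, `t̄⁻¹(W)` is OPEN in
  `Gal(k^ab/k)`: its preimage in `k_𝐀^×` is `T⁻¹(W) ⊇ ker(χ ∘ fin) ∩ f⁻¹(W)`, open, and contains
  `k^×`, hence has finite index (`finiteIndex_of_isOpen_of_principalIdeles_le`, Tate VII §5.1); so
  Tate's criterion `isOpen_of_isOpen_comap_ideleArtinMap` («`G(K^ab/K) ≃ lim C_K/N` over the open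
  subgroups of finite index», the existence theorem) applies.  **`continuous_twistHom`**: `t̄` is
  continuous (the congruence subgroups are a basis of `1` in `K̂_f^×`).
* §5 **`isOpen_setOf_twistHom_mem_stabilizer`** — the engine's hypothesis: for a fractional ideal
  `𝔞` and finitely many points `W ⊆ K/𝔞`, `{σ | c_σ𝔞 = 𝔞 and c_σ w = w for all w ∈ W}` is open
  (`IdeleAction.isOpen_stabilizer`, Shimura (18.9a) / Neukirch VI (1.8)).

## References

* [Shimura1998] G. Shimura, *Abelian Varieties with Complex Multiplication and Modular Functions*
  (1998), §21.4 proof of Thm. 21.4 (pp. 147–148), §18.3 (p. 122), Prop. 19.10 (19.10b) (p. 135), §18.9.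
* [CasselsFrohlichANT1967] J. Tate, *Global class field theory*, Ch. VII of Cassels–Fröhlich
  (1967), §5.1 (D) and remark, §5.4.
* [NeukirchANT1999] J. Neukirch, *Algebraic Number Theory* (1999), Ch. VII §6 (6.11) (module of
  definition), Ch. VI §1 (1.8).
-/

set_option autoImplicit false

noncomputable section

open NumberField Field Topology IsDedekindDomain
open scoped nonZeroDivisors

namespace Literature.NumberTheory.ComplexMultiplication

open Literature.NumberTheory.GaloisRepresentations
open Literature.NumberTheory.GaloisRepresentations.HeckeCharacter (infPart)
open Literature.NumberTheory.NumberFields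
open Literature.NumberTheory.NumberFields.IdeleIdeal (toIdealUnits)

/-! ## §1. `y ↦ χ(y_fin)` has open kernel -/

section FinitePart

variable {k : Type} [Field k] [NumberField k]

/-- The «finite part» `y ↦ y_fin = (y_∞, 1)⁻¹ · y` of an idèle is a homomorphism (the idèle group is
commutative). [folklore] -/
private theorem finitePart_mul (y y' : ideleGroup k) :
    (infiniteIdeles k (infPart k (y * y')))⁻¹ * (y * y') =
      ((infiniteIdeles k (infPart k y))⁻¹ * y) * ((infiniteIdeles k (infPart k y'))⁻¹ * y') := by
  rw [map_mul, map_mul, mul_inv, mul_mul_mul_comm]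

/-- The finite part `𝕀_k → (𝔸_{k,f})ˣ`, `x ↦ x_f`, is continuous. [folklore] -/
private theorem continuous_finPart : Continuous (ideleGroup.finPart k) :=
  Continuous.units_map _ continuous_snd

/-- The closed `v`-adic ball `{x ∈ k_v : |x − 1|_v ≤ q_v^{−n}}` is open (`k_v` is non-archimedean;
Mathlib `Valued.isOpen_closedBall` at the radius `|π^n|_v` of a uniformizer `π`; same proof as the
private lemma of `NumberFields/IdeleStabilizerOfLatticePoints`). [folklore] -/
private theorem isOpen_setOf_valued_sub_one_le (v : HeightOneSpectrum (𝓞 k)) (n : ℤ) :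
    IsOpen {x : v.adicCompletion k | Valued.v (x - 1) ≤ WithZero.exp (-n)} := by
  obtain ⟨π, hπ⟩ := v.valuation_exists_uniformizer k
  have hπ0 : π ≠ 0 := by
    rintro rfl
    rw [Valuation.map_zero] at hπ
    exact WithZero.zero_ne_coe hπ
  set z : v.adicCompletion k := ((π ^ n : k) : v.adicCompletion k) with hzdef
  have hz : Valued.v z = WithZero.exp (-n) := by
    rw [hzdef, IsDedekindDomain.HeightOneSpectrum.valuedAdicCompletion_eq_valuation', map_zpow₀, hπ, ← WithZero.exp_zsmul, smul_eq_mul,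
      mul_neg, mul_one]
  have hz_ne : z ≠ 0 := by
    intro h
    rw [h, Valuation.map_zero] at hz
    exact WithZero.exp_ne_zero hz.symm
  have hz0 : Valued.v.restrict z ≠ 0 := (Valuation.ne_zero_iff _).mpr hz_ne
  have hc : IsOpen {y : v.adicCompletion k | Valued.v y ≤ Valued.v z} := by
    simpa only [Valuation.restrict_le_iff] using Valued.isOpen_closedBall (v.adicCompletion k) hz0
  rw [← hz]
  exact hc.preimage (continuous_id.sub continuous_const)

/-- **`y ↦ χ(y_fin)` has OPEN kernel**: there is an open subgroup `U ≤ k_𝐀^×` with `χ(z_fin) = 1` for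
all `z ∈ U` — for a module of definition `(T, e)` of `χ` (`exists_isModulus`: `χ` kills the idèles
`x` with `x_∞ = 1`, all `x_v` units, `x_v ≡ 1 mod 𝔭_v^{e_v}` for `v ∈ T`), `U` can be taken to be the
open set of idèles whose finite components satisfy these unit and congruence conditions.  (Declared
with its absolute name as a dot-notation extension of the structure `HeckeCharacter` of
`GaloisRepresentations/HeckeCharacter`.) [cite: NeukirchANT1999, Ch. VII §6 (6.11) (χ(I_f^𝔪) = 1)] -/
theorem _root_.Literature.NumberTheory.GaloisRepresentations.HeckeCharacter.exists_isOpen_subgroup_apply_finitePart_eq_one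
    (χ : HeckeCharacter k) :
    ∃ U : Subgroup (ideleGroup k), IsOpen (U : Set (ideleGroup k)) ∧
      ∀ z ∈ U, χ ((infiniteIdeles k (infPart k z))⁻¹ * z) = 1 := by
  obtain ⟨T, e, hmod⟩ := HeckeCharacter.exists_isModulus χ
  -- the homomorphism `ψ = χ ∘ fin`
  let ψ : ideleGroup k →* ℂˣ :=
    { toFun := fun y => χ ((infiniteIdeles k (infPart k y))⁻¹ * y)
      map_one' := by rw [map_one, map_one, inv_one, one_mul, map_one]
      map_mul' := fun y y' => by rw [finitePart_mul, map_mul] }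
  refine ⟨ψ.ker, ?_, fun z hz => (MonoidHom.mem_ker).1 hz⟩
  -- `ker ψ` contains the open neighbourhood `V` of `1` cut out by the module of definition
  let V : Set (ideleGroup k) :=
    {z | ideleGroup.finPart k z ∈ (toIdealUnits (𝓞 k) k).ker} ∩
      ⋂ v ∈ T, {z | Valued.v (((z : ideleGroup k) : AdeleRing (𝓞 k) k).2 v - 1) ≤
        WithZero.exp (-(e v : ℤ))}
  have hVopen : IsOpen V := by
    refine (IdeleAction.isOpen_ker_toIdealUnits.preimage continuous_finPart).inter
      (T.finite_toSet.isOpen_biInter fun v _ => ?_)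
    have hc : Continuous fun z : ideleGroup k => (z : AdeleRing (𝓞 k) k).2 v :=
      (IdeleIdeal.continuous_apply v).comp continuous_finPart
    exact (isOpen_setOf_valued_sub_one_le v (e v)).preimage hc
  have h1V : (1 : ideleGroup k) ∈ V := by
    refine ⟨by simp only [Set.mem_setOf_eq, map_one]; exact one_mem _, Set.mem_iInter₂.2 fun v _ => ?_⟩
    have h1 : (((1 : ideleGroup k) : AdeleRing (𝓞 k) k).2 v) = 1 := rfl
    simp only [Set.mem_setOf_eq, h1, sub_self, map_zero]
    exact zero_le
  have hVψ : V ⊆ (ψ.ker : Set (ideleGroup k)) := by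
    rintro z ⟨hz1, hz2⟩
    rw [SetLike.mem_coe, MonoidHom.mem_ker]
    change χ ((infiniteIdeles k (infPart k z))⁻¹ * z) = 1
    have hfin := HeckeCharacter.infiniteIdeles_infPart_inv_mul z
    refine hmod _ hfin.1 (fun v => ?_) (fun v hv => ?_)
    · rw [hfin.2 v, ← ideleGroup.val_finPart_apply]
      exact (IdeleIdeal.mem_ker_toIdealUnits_iff_valued _).1 hz1 v
    · rw [hfin.2 v]
      exact (Set.mem_iInter₂.1 hz2) v hv
  exact ψ.ker.isOpen_of_mem_nhds (Filter.mem_of_superset (hVopen.mem_nhds h1V) hVψ)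

end FinitePart

/-! ## §2. The twist `y ↦ c(y) = β(y) f(y)⁻¹` is a homomorphism `k_𝐀^× →* K̂_f^×` -/

section Twist

variable {k : Type} [Field k] [NumberField k] {K : Type} [Field K] [NumberField K]
  (χ : HeckeCharacter k) (τ₀ : K →+* ℂ) (f : ideleGroup k →* (FiniteAdeleRing (𝓞 K) K)ˣ)

omit [NumberField K] in
/-- For every idèle `y` there is a UNIQUE `b ∈ K^×` with `χ(y_fin) = τ₀(b)`, once (19.10b) «`χ(x) ∈ K^×`
for `x ∈ k_h^×`» holds (`hb`): existence from `hb` at `y_fin` (whose archimedean part is `1`),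
`b ≠ 0` as `χ(y_fin) ≠ 0`, uniqueness as `τ₀` is injective. [cite: Shimura1998, §19.10 Prop. 19.10 (19.10b) p. 135] -/
theorem existsUnique_units_coe_apply_finitePart_eq
    (hb : ∀ x : ideleGroup k, (x : AdeleRing (𝓞 k) k).1 = 1 → ∃ b : K, ((χ x : ℂˣ) : ℂ) = τ₀ b)
    (y : ideleGroup k) :
    ∃! b : Kˣ, ((χ ((infiniteIdeles k (infPart k y))⁻¹ * y) : ℂˣ) : ℂ) = τ₀ (b : K) := by
  obtain ⟨b, hβ⟩ := hb _ (HeckeCharacter.infiniteIdeles_infPart_inv_mul y).1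
  have hb0 : b ≠ 0 := fun h => by
    rw [h, map_zero] at hβ
    exact (χ ((infiniteIdeles k (infPart k y))⁻¹ * y)).ne_zero hβ
  refine ⟨Units.mk0 b hb0, hβ, fun b' hb' => Units.ext (τ₀.injective ?_)⟩
  rw [Units.val_mk0, ← hβ, hb']

/-- **Shimura's twist `c(y) = β(y) f(y)⁻¹` is a homomorphism of the idèle group**: there is a (unique)
homomorphism `T : k_𝐀^× →* K̂_f^×` with `T(y) = b · f(y)⁻¹` whenever `χ(y_fin) = τ₀(b)`, `b ∈ K^×`
(`β : y ↦ τ₀⁻¹(χ(y_fin))` is multiplicative since `τ₀` is injective and `y ↦ χ(y_fin)` is a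
homomorphism; Shimura pp. 147–148: «`c = β(y)f(y)⁻¹`», `β(x) = χ(x_h)`).
[cite: Shimura1998, §21.4, proof of Thm. 21.4 (pp. 147–148) («put c = β(y)f(y)⁻¹», «β(x) = χ(x_h)»)] -/
theorem exists_twistIdeleHom
    (hb : ∀ x : ideleGroup k, (x : AdeleRing (𝓞 k) k).1 = 1 → ∃ b : K, ((χ x : ℂˣ) : ℂ) = τ₀ b) :
    ∃ T : ideleGroup k →* (FiniteAdeleRing (𝓞 K) K)ˣ, ∀ (y : ideleGroup k) (b : Kˣ),
      ((χ ((infiniteIdeles k (infPart k y))⁻¹ * y) : ℂˣ) : ℂ) = τ₀ (b : K) →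
        T y = FiniteAdeleRing.unitEmbedding (𝓞 K) K b * (f y)⁻¹ := by
  choose β hβ hβu using existsUnique_units_coe_apply_finitePart_eq χ τ₀ hb
  beta_reduce at hβ hβu
  -- `β` is a homomorphism `k_𝐀^× →* K^×`
  have hβ1 : β 1 = 1 := (hβu 1 1 (by
    rw [map_one (infPart k), map_one (infiniteIdeles k), inv_one, one_mul, map_one χ, Units.val_one,
      Units.val_one, map_one τ₀])).symm
  have hβmul : ∀ y y' : ideleGroup k, β (y * y') = β y * β y' := fun y y' => (hβu (y * y') _ (by
    rw [finitePart_mul, map_mul χ, Units.val_mul, Units.val_mul, map_mul τ₀, ← hβ y, ← hβ y'])).symm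
  let βHom : ideleGroup k →* Kˣ := { toFun := β, map_one' := hβ1, map_mul' := hβmul }
  refine ⟨((FiniteAdeleRing.unitEmbedding (𝓞 K) K).comp βHom) * f⁻¹, fun y b h => ?_⟩
  rw [hβu y b h]
  rfl

end Twist

/-! ## §3. The twist factors through `[·, k]`: the twist character `t̄ : Gal(k^ab/k) →* K̂_f^×` -/

section TwistHom

variable {k : Type} [Field k] [NumberField k] {K : Type} [Field K] [NumberField K]
  (χ : HeckeCharacter k) (τ₀ : K →+* ℂ) (f : ideleGroup k →* (FiniteAdeleRing (𝓞 K) K)ˣ)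

/-- **The twist character `t̄ : Gal(k^ab/k) → K̂_f^×`** (Shimura pp. 147–148: «Since `c` is uniquely determined
by `σ`…»).  If `c(y, b) = b · f(y)⁻¹` depends only on `[y, k]` (`hindep`, the content of class field
theory + (19.10a): stub `stub_twistIdeleIndependent` of the tree's `Hyp21` line) and (19.10b) holds
(`hb`), then there is a homomorphism `t̄ : Gal(k^ab/k) →* K̂_f^×` with `t̄ [y, k] = b · f(y)⁻¹` whenever
`χ(y_fin) = τ₀ b` (`[·, k]` = `NumberFields.ideleArtinMap k` is onto, and the twist homomorphism of
`exists_twistIdeleHom` kills its kernel). [cite: Shimura1998, §21.4, proof of Thm. 21.4 (pp. 147–148) («c is uniquely determined by σ»); §18.3 p. 122 («[a, M]»)] -/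
theorem exists_twistHom_ideleArtinMap
    (hb : ∀ x : ideleGroup k, (x : AdeleRing (𝓞 k) k).1 = 1 → ∃ b : K, ((χ x : ℂˣ) : ℂ) = τ₀ b)
    (hindep : ∀ y y' : ideleGroup k, ideleArtinMap k y = ideleArtinMap k y' → ∀ b b' : Kˣ,
      ((χ ((infiniteIdeles k (infPart k y))⁻¹ * y) : ℂˣ) : ℂ) = τ₀ (b : K) →
      ((χ ((infiniteIdeles k (infPart k y'))⁻¹ * y') : ℂˣ) : ℂ) = τ₀ (b' : K) →
        FiniteAdeleRing.unitEmbedding (𝓞 K) K b * (f y)⁻¹ =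
          FiniteAdeleRing.unitEmbedding (𝓞 K) K b' * (f y')⁻¹) :
    ∃ t : absoluteGaloisGroupAbelianization k →* (FiniteAdeleRing (𝓞 K) K)ˣ,
      ∀ (y : ideleGroup k) (b : Kˣ),
        ((χ ((infiniteIdeles k (infPart k y))⁻¹ * y) : ℂˣ) : ℂ) = τ₀ (b : K) →
          t (ideleArtinMap k y) = FiniteAdeleRing.unitEmbedding (𝓞 K) K b * (f y)⁻¹ := by
  obtain ⟨T, hT⟩ := exists_twistIdeleHom χ τ₀ f hb
  have hβ : ∀ y : ideleGroup k, ∃ b : Kˣ,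
      ((χ ((infiniteIdeles k (infPart k y))⁻¹ * y) : ℂˣ) : ℂ) = τ₀ (b : K) :=
    fun y => (existsUnique_units_coe_apply_finitePart_eq χ τ₀ hb y).exists
  -- `T` is constant on the fibres of `[·, k]`, in particular it kills `ker [·, k]`
  have hconst : ∀ y y' : ideleGroup k, ideleArtinMap k y = ideleArtinMap k y' → T y = T y' := by
    intro y y' hyy'
    obtain ⟨b, hby⟩ := hβ y
    obtain ⟨b', hby'⟩ := hβ y'
    rw [hT y b hby, hT y' b' hby', hindep y y' hyy' b b' hby hby']
  have hker : (ideleArtinMap k).ker ≤ T.ker := fun y hy => by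
    rw [MonoidHom.mem_ker] at hy ⊢
    rw [hconst y 1 (by rw [hy, map_one]), map_one]
  refine ⟨(ideleArtinMap k).liftOfRightInverse (Function.surjInv (ideleArtinMap_surjective k))
    (Function.rightInverse_surjInv _) ⟨T, hker⟩, fun y b h => ?_⟩
  rw [MonoidHom.liftOfRightInverse_comp_apply]
  exact hT y b h

/-- **Uniqueness of the twist character**: a homomorphism `Gal(k^ab/k) → K̂_f^×` is determined by its
values `b · f(y)⁻¹` on the `[y, k]` (`[·, k]` is onto and every `y` has its `b`, `hb`).
[cite: Shimura1998, §21.4, proof of Thm. 21.4 (pp. 147–148); §18.3 p. 122] -/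
theorem twistHom_unique
    (hb : ∀ x : ideleGroup k, (x : AdeleRing (𝓞 k) k).1 = 1 → ∃ b : K, ((χ x : ℂˣ) : ℂ) = τ₀ b)
    (t t' : absoluteGaloisGroupAbelianization k →* (FiniteAdeleRing (𝓞 K) K)ˣ)
    (ht : ∀ (y : ideleGroup k) (b : Kˣ),
      ((χ ((infiniteIdeles k (infPart k y))⁻¹ * y) : ℂˣ) : ℂ) = τ₀ (b : K) →
        t (ideleArtinMap k y) = FiniteAdeleRing.unitEmbedding (𝓞 K) K b * (f y)⁻¹)
    (ht' : ∀ (y : ideleGroup k) (b : Kˣ),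
      ((χ ((infiniteIdeles k (infPart k y))⁻¹ * y) : ℂˣ) : ℂ) = τ₀ (b : K) →
        t' (ideleArtinMap k y) = FiniteAdeleRing.unitEmbedding (𝓞 K) K b * (f y)⁻¹) :
    t = t' := by
  refine MonoidHom.ext fun σ => ?_
  obtain ⟨y, rfl⟩ := ideleArtinMap_surjective k σ
  obtain ⟨b, hby⟩ := (existsUnique_units_coe_apply_finitePart_eq χ τ₀ hb y).exists
  rw [ht y b hby, ht' y b hby]

/-! ## §4. The twist character is continuous -/

/-- **`t̄⁻¹(W)` is open for every open subgroup `W ≤ K̂_f^×`.**  Let `t̄ : Gal(k^ab/k) →* K̂_f^×` satisfy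
`t̄ [y, k] = b · f(y)⁻¹` whenever `χ(y_fin) = τ₀ b` (e.g. the twist character of
`exists_twistHom_ideleArtinMap`), with `f` continuous.  Then for an open subgroup `W`: the preimage of
`H = t̄⁻¹(W)` under `[·, k]` contains `ker(χ ∘ fin) ∩ f⁻¹(W)` (on `ker(χ ∘ fin)` one may take `b = 1`),
which is open (§1), so it is an open subgroup of `k_𝐀^×`; it contains `k^×`, hence has FINITE INDEX
(Tate VII §5.1: open subgroups of `C_k` have finite index, `finiteIndex_of_isOpen_of_principalIdeles_le`),
so `H` has finite index; and a finite-index subgroup of `Gal(k^ab/k)` with open preimage in `k_𝐀^×` is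
OPEN (Tate VII §5.4 «`G(K^ab/K) ≃ lim C_K/N` over the open `N` of finite index» = the existence theorem,
`isOpen_of_isOpen_comap_ideleArtinMap`). [cite: CasselsFrohlichANT1967, Ch. VII §5.1 (D) with remark and §5.4 (PDF pp. 212–213)] [cite: Shimura1998, §21.4, proof of Thm. 21.4 (pp. 147–148)] -/
theorem isOpen_comap_twistHom (hf : Continuous f)
    (t : absoluteGaloisGroupAbelianization k →* (FiniteAdeleRing (𝓞 K) K)ˣ)
    (ht : ∀ (y : ideleGroup k) (b : Kˣ),
      ((χ ((infiniteIdeles k (infPart k y))⁻¹ * y) : ℂˣ) : ℂ) = τ₀ (b : K) →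
        t (ideleArtinMap k y) = FiniteAdeleRing.unitEmbedding (𝓞 K) K b * (f y)⁻¹)
    (W : Subgroup (FiniteAdeleRing (𝓞 K) K)ˣ) (hW : IsOpen (W : Set (FiniteAdeleRing (𝓞 K) K)ˣ)) :
    IsOpen ((W.comap t : Subgroup (absoluteGaloisGroupAbelianization k)) :
      Set (absoluteGaloisGroupAbelianization k)) := by
  obtain ⟨U, hUopen, hU⟩ := χ.exists_isOpen_subgroup_apply_finitePart_eq_one
  set H : Subgroup (absoluteGaloisGroupAbelianization k) := W.comap t with hH
  -- the preimage of `H` in the idèles contains the open subgroup `U ⊓ f⁻¹(W)`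
  have hle : U ⊓ W.comap f ≤ H.comap (ideleArtinMap k) := by
    rintro z ⟨hzU, hzW⟩
    rw [Subgroup.mem_comap, hH, Subgroup.mem_comap, ht z 1 (by rw [hU z hzU, Units.val_one,
      Units.val_one, map_one]), map_one, one_mul]
    exact W.inv_mem hzW
  have hopen : IsOpen ((H.comap (ideleArtinMap k) : Subgroup (ideleGroup k)) : Set (ideleGroup k)) :=
    Subgroup.isOpen_mono hle (by rw [Subgroup.coe_inf]; exact hUopen.inter (hW.preimage hf))
  -- it contains `k^×`, so it (and hence `H`) has finite index
  have hP : principalIdeles k ≤ H.comap (ideleArtinMap k) := fun a ha => by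
    rw [Subgroup.mem_comap, ideleArtinMap_eq_one_of_mem_principalIdeles ha]
    exact one_mem _
  have hfi := finiteIndex_of_isOpen_of_principalIdeles_le _ hopen hP
  haveI : H.FiniteIndex :=
    ⟨by rw [← Subgroup.index_comap_of_surjective H (ideleArtinMap_surjective k)]; exact hfi.index_ne_zero⟩
  exact isOpen_of_isOpen_comap_ideleArtinMap H hopen

/-- **The twist character is CONTINUOUS** (`Gal(k^ab/k)` with the Krull topology, `K̂_f^×` with the
finite-idèle topology): the congruence subgroups `I^𝔪` form a basis of neighbourhoods of `1` in `K̂_f^×`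
(`IdeleAction.exists_congruenceUnits_subset_of_mem_nhds`, Neukirch VI (1.8)) and each `t̄⁻¹(I^𝔪)` is
open (`isOpen_comap_twistHom`). [cite: CasselsFrohlichANT1967, Ch. VII §5.1 (D) and §5.4 (PDF pp. 212–213)] [cite: NeukirchANT1999, Ch. VI §1 Prop. (1.8)] -/
theorem continuous_twistHom (hf : Continuous f)
    (t : absoluteGaloisGroupAbelianization k →* (FiniteAdeleRing (𝓞 K) K)ˣ)
    (ht : ∀ (y : ideleGroup k) (b : Kˣ),
      ((χ ((infiniteIdeles k (infPart k y))⁻¹ * y) : ℂˣ) : ℂ) = τ₀ (b : K) →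
        t (ideleArtinMap k y) = FiniteAdeleRing.unitEmbedding (𝓞 K) K b * (f y)⁻¹) :
    Continuous t := by
  refine continuous_of_continuousAt_one t ?_
  rw [ContinuousAt, map_one, Filter.tendsto_def]
  intro V hV
  obtain ⟨𝔪, -, h𝔪⟩ := IdeleAction.exists_congruenceUnits_subset_of_mem_nhds hV
  have hopen := isOpen_comap_twistHom χ τ₀ f hf t ht (IdeleAction.congruenceUnits (K := K) 𝔪)
    (IdeleAction.isOpen_congruenceUnits 𝔪)
  exact Filter.mem_of_superset (hopen.mem_nhds (one_mem _)) (Set.preimage_mono h𝔪)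

/-! ## §5. The hypothesis `hc` of the finite-level engine: stabilisers of points of `K/𝔞` are open -/

/-- **Levelwise open stabilisers** (hypothesis `hc` of
`GroupTheory.exists_isOpen_subgroup_forall_smul_eq_of_levelwise`): for a fractional ideal `𝔞 ≠ 0` of
`𝓞_K` and FINITELY many points `W ⊆ K/𝔞`, the set of `σ ∈ Gal(k^ab/k)` whose twist `c_σ = t̄(σ)`
satisfies `c_σ𝔞 = 𝔞` and `c_σ · w = w` for every `w ∈ W` ((18.3a)) is OPEN — the stabiliser of
`(𝔞; W)` in `K̂_f^×` is an open subgroup (it contains a congruence subgroup, Shimura (18.9a) /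
Neukirch VI (1.8): `IdeleAction.isOpen_stabilizer`) and `t̄` pulls open subgroups back to open
subgroups (`isOpen_comap_twistHom`). [cite: Shimura1998, §21.4, proof of Thm. 21.4 (pp. 147–148); §18.9 (18.9a) p. 130; §18.3 (18.3a) p. 122] [cite: NeukirchANT1999, Ch. VI §1 Prop. (1.8)] -/
theorem isOpen_setOf_twistHom_mem_stabilizer (hf : Continuous f)
    (t : absoluteGaloisGroupAbelianization k →* (FiniteAdeleRing (𝓞 K) K)ˣ)
    (ht : ∀ (y : ideleGroup k) (b : Kˣ),
      ((χ ((infiniteIdeles k (infPart k y))⁻¹ * y) : ℂˣ) : ℂ) = τ₀ (b : K) →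
        t (ideleArtinMap k y) = FiniteAdeleRing.unitEmbedding (𝓞 K) K b * (f y)⁻¹)
    (𝔞 : FractionalIdeal (𝓞 K)⁰ K) (h𝔞 : 𝔞 ≠ 0) {W : Set (K ⧸ (𝔞 : Submodule (𝓞 K) K))}
    (hW : W.Finite) :
    IsOpen {σ : absoluteGaloisGroupAbelianization k | t σ ∈ IdeleAction.stabilizer 𝔞 h𝔞 W} :=
  isOpen_comap_twistHom χ τ₀ f hf t ht (IdeleAction.stabilizer 𝔞 h𝔞 W)
    (IdeleAction.isOpen_stabilizer h𝔞 W hW)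

/-- The same, unfolded ((18.3a) on representatives): `{σ | c_σ𝔞 = 𝔞 ∧ ∀ u, (u mod 𝔞) ∈ W →
c_σ · (u mod 𝔞) = u (mod c_σ𝔞)}` is open. [cite: Shimura1998, §18.3 (18.3a) p. 122; §18.9 (18.9a) p. 130] -/
theorem isOpen_setOf_twistHom_ideleMulEquiv_eq (hf : Continuous f)
    (t : absoluteGaloisGroupAbelianization k →* (FiniteAdeleRing (𝓞 K) K)ˣ)
    (ht : ∀ (y : ideleGroup k) (b : Kˣ),
      ((χ ((infiniteIdeles k (infPart k y))⁻¹ * y) : ℂˣ) : ℂ) = τ₀ (b : K) →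
        t (ideleArtinMap k y) = FiniteAdeleRing.unitEmbedding (𝓞 K) K b * (f y)⁻¹)
    (𝔞 : FractionalIdeal (𝓞 K)⁰ K) (h𝔞 : 𝔞 ≠ 0) {W : Set (K ⧸ (𝔞 : Submodule (𝓞 K) K))}
    (hW : W.Finite) :
    IsOpen {σ : absoluteGaloisGroupAbelianization k |
      IdeleAction.ideleMulIdeal (t σ) 𝔞 = 𝔞 ∧ ∀ u : K, Submodule.Quotient.mk u ∈ W →
        IdeleAction.ideleMulEquiv (t σ) 𝔞 h𝔞 (Submodule.Quotient.mk u) = Submodule.Quotient.mk u} :=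
  isOpen_setOf_twistHom_mem_stabilizer χ τ₀ f hf t ht 𝔞 h𝔞 hW

/-- **Summary (FL adapter (A3) in one statement).**  Under (19.10b) (`hb`), the lift-independence of the
twist (`hindep`, stub `stub_twistIdeleIndependent`) and the continuity of `f`: there is a CONTINUOUS
homomorphism `t̄ : Gal(k^ab/k) →* K̂_f^×` with `t̄ [y, k] = b · f(y)⁻¹` whenever `χ(y_fin) = τ₀ b`, and for
every fractional ideal `𝔞 ≠ 0` and finitely many points `W ⊆ K/𝔞` the `σ` whose twist stabilises
`(𝔞; W)` form an open set. [cite: Shimura1998, §21.4, proof of Thm. 21.4 (pp. 147–148); §18.3 p. 122, §18.9 (18.9a) p. 130] [cite: CasselsFrohlichANT1967, Ch. VII §5.1 (D) and §5.4 (PDF pp. 212–213)] -/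
theorem exists_continuous_twistHom (hf : Continuous f)
    (hb : ∀ x : ideleGroup k, (x : AdeleRing (𝓞 k) k).1 = 1 → ∃ b : K, ((χ x : ℂˣ) : ℂ) = τ₀ b)
    (hindep : ∀ y y' : ideleGroup k, ideleArtinMap k y = ideleArtinMap k y' → ∀ b b' : Kˣ,
      ((χ ((infiniteIdeles k (infPart k y))⁻¹ * y) : ℂˣ) : ℂ) = τ₀ (b : K) →
      ((χ ((infiniteIdeles k (infPart k y'))⁻¹ * y') : ℂˣ) : ℂ) = τ₀ (b' : K) →
        FiniteAdeleRing.unitEmbedding (𝓞 K) K b * (f y)⁻¹ =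
          FiniteAdeleRing.unitEmbedding (𝓞 K) K b' * (f y')⁻¹) :
    ∃ t : absoluteGaloisGroupAbelianization k →* (FiniteAdeleRing (𝓞 K) K)ˣ,
      (∀ (y : ideleGroup k) (b : Kˣ),
        ((χ ((infiniteIdeles k (infPart k y))⁻¹ * y) : ℂˣ) : ℂ) = τ₀ (b : K) →
          t (ideleArtinMap k y) = FiniteAdeleRing.unitEmbedding (𝓞 K) K b * (f y)⁻¹) ∧
      Continuous t ∧
      ∀ (𝔞 : FractionalIdeal (𝓞 K)⁰ K) (h𝔞 : 𝔞 ≠ 0) (W : Set (K ⧸ (𝔞 : Submodule (𝓞 K) K))),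
        W.Finite → IsOpen {σ : absoluteGaloisGroupAbelianization k | t σ ∈ IdeleAction.stabilizer 𝔞 h𝔞 W} := by
  obtain ⟨t, ht⟩ := exists_twistHom_ideleArtinMap χ τ₀ f hb hindep
  exact ⟨t, ht, continuous_twistHom χ τ₀ f hf t ht, fun 𝔞 h𝔞 _ hW =>
    isOpen_setOf_twistHom_mem_stabilizer χ τ₀ f hf t ht 𝔞 h𝔞 hW⟩

end TwistHom


end Literature.NumberTheory.ComplexMultiplication

end
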